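import Mathlib
import HarnessLib
import Literature.MathematicalPhysics.QuantumFieldTheory.ConstructiveQFTWave0Proofs
import Literature.MathematicalPhysics.QuantumFieldTheory.ConstructiveQFTWave0SiteRPProofs
import Literature.MathematicalPhysics.QuantumFieldTheory.ConstructiveQFTWave0OddRPProofs
import Literature.MathematicalPhysics.QuantumFieldTheory.LatticeGaugeProofs
import Literature.MathematicalPhysics.QuantumFieldTheory.LatticeGaugeStaticPotentialProofs
import Literature.MathematicalPhysics.QuantumFieldTheory.WilsonSiteRPForm
import Summits.QuantumFields.YangMills.Theorems.FradkinShenkerFlowFiniteSusceptibilityWeakCouplingRPCauchySchwarz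

/-!
# Crux `FemtoCurvatureTwoPoint` (stmt-QuantumFields-9363, route `LangevinControlUV`):
# mirror plaquette pairs have non-negative covariance (reflection positivity), part 1 of 2

Helper for the line `generic-step-gamma-encoding` (lead prover, `--supports stmt-QuantumFields-9363`).
Part 1 (this file): for EVERY compact group `G`, every continuous matrix representation `ρ` and every
torus `(ℤ/L)^d`, the covariance of a SPATIAL plaquette function `Re tr ρ(U_p)` with its mirror image is
non-negative under Wilson's lattice gauge measure `wilsonMeasure ρ β`, for each of the three reflections
whose positivity is proved in the tree: the link reflection `θ t = 1 − t` for even `L`, `β ≥ 0`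
(`wilsonExpectation_reflectionPositive_holds`; here `cov_timeReflect_pair_nonneg_even`), the site
reflection `θ' t = −t` for even `L`, any `β` (`wilsonExpectation_siteReflectionPositive`;
`cov_negReflect_pair_nonneg`) and the odd-torus reflection for odd `L ≥ 3`, `β ≥ 0`
(`wilsonExpectation_oddReflectionPositive`; `cov_timeReflect_pair_nonneg_odd`). Mechanism: the
reflections preserve the Wilson state, so the uncentred positivity `⟨F̂ ∘ Θ, F̂⟩ ≥ 0` of the CENTRED
observable `F̂ = F − E F` is exactly `Cov(F ∘ Θ, F) ≥ 0` (`cov_comp_nonneg_of_centred`), and a spatial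
plaquette in the positive half reflects onto the same plaquette at the mirror time.
Part 2 (`LangevinControlUVFemtoCurvatureTwoPointAxisCovNonneg`): translation to the origin, the case
analysis over the parities of `L` and `n`, and the crux's reference pair `Cov(P_0^{01}, P_{ne₂}^{01}) ≥ 0`.
-/

noncomputable section

open MeasureTheory
open Literature.MathematicalPhysics.QuantumFieldTheory

namespace Summit.QuantumFields.YangMills.Theorems.FemtoCurvatureTwoPoint.AxisCovNonneg

/-! ## Abstract centring: uncentred positivity of the centred observable gives `Cov ≥ 0` -/

section Abstract

variable {Ω : Type*} [MeasurableSpace Ω] {μ : Measure Ω} [IsProbabilityMeasure μ] {Θ : Ω → Ω}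

/-- If `Θ` preserves the probability measure `μ` and the reflection form of the CENTRED bounded
measurable observable `F − E F` is non-negative, then `E[(F∘Θ)·F] − E[F∘Θ]·E[F] ≥ 0`. [folklore] -/
theorem cov_comp_nonneg_of_centred (hΘm : Measurable Θ) (hΘμ : μ.map Θ = μ) {F : Ω → ℝ}
    (hF : Measurable F) (hFb : ∃ C : ℝ, ∀ ω, |F ω| ≤ C)
    (h : 0 ≤ ∫ ω, (F (Θ ω) - ∫ x, F x ∂μ) * (F ω - ∫ x, F x ∂μ) ∂μ) :
    0 ≤ ∫ ω, F (Θ ω) * F ω ∂μ - (∫ ω, F (Θ ω) ∂μ) * ∫ ω, F ω ∂μ := by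
  obtain ⟨C, hC⟩ := hFb
  set m : ℝ := ∫ x, F x ∂μ with hm
  have hΘF : ∫ ω, F (Θ ω) ∂μ = m :=
    FiniteSusceptibilityWeakCoupling.RPCauchySchwarz.integral_comp_eq hΘm hΘμ hF
  have hbd : ∀ ω, ‖F ω‖ ≤ C := fun ω => by rw [Real.norm_eq_abs]; exact hC ω
  have iF : Integrable F μ := Integrable.of_bound hF.aestronglyMeasurable C (ae_of_all _ hbd)
  have iFΘ : Integrable (fun ω => F (Θ ω)) μ :=
    Integrable.of_bound (hF.comp hΘm).aestronglyMeasurable C (ae_of_all _ fun ω => hbd _)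
  have iprod : Integrable (fun ω => F (Θ ω) * F ω) μ :=
    FiniteSusceptibilityWeakCoupling.RPCauchySchwarz.integrable_comp_mul hΘm hF hF hC hC
  have hexp : (fun ω => (F (Θ ω) - m) * (F ω - m)) =
      fun ω => (F (Θ ω) * F ω - m * F ω) - (m * F (Θ ω) - m * m) := by
    funext ω; ring
  have i1 : Integrable (fun ω => F (Θ ω) * F ω - m * F ω) μ := iprod.sub (iF.const_mul m)
  have i2 : Integrable (fun ω => m * F (Θ ω) - m * m) μ := (iFΘ.const_mul m).sub (integrable_const _)
  have hval : ∫ ω, (F (Θ ω) - m) * (F ω - m) ∂μ = ∫ ω, F (Θ ω) * F ω ∂μ - m * m := by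
    rw [hexp, integral_sub i1 i2, integral_sub iprod (iF.const_mul m),
      integral_sub (iFΘ.const_mul m) (integrable_const _), integral_const_mul, integral_const_mul,
      hΘF, integral_const, probReal_univ, one_smul, ← hm]
    ring
  rw [hval] at h
  rw [hΘF]
  linarith

end Abstract

/-! ## The three reflection positivities of the tree, real uncentred form -/

section RealRP

variable {d L N : ℕ} {G : Type*} [Group G] [TopologicalSpace G] [IsTopologicalGroup G]
  [CompactSpace G] [MeasurableSpace G] [BorelSpace G] (ρ : G →* Matrix (Fin N) (Fin N) ℂ)

/-- Real reading of the tree's link reflection positivity (`θ t = 1 − t`, `L` even, `β ≥ 0`):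
`0 ≤ ∫ F(Θ₀U) F(U) dμ_β` for bounded measurable real positive-time observables. [folklore] -/
theorem integral_timeReflect_mul_nonneg_even [NeZero d] [NeZero L] (hL : Even L)
    (hρ : Continuous ρ) {β : ℝ} (hβ : 0 ≤ β) (F : GaugeConfig d L G → ℝ) (hF : Measurable F)
    (hFb : ∃ C : ℝ, ∀ U, |F U| ≤ C) (hFpos : IsPositiveTimeObservable F) :
    0 ≤ ∫ U, F (GaugeConfig.timeReflect U) * F U ∂(wilsonMeasure (d := d) (L := L) ρ β) := by
  obtain ⟨C, hC⟩ := hFb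
  have h := wilsonExpectation_reflectionPositive_holds (d := d) (L := L) ρ hL hρ hβ
    (fun U => ((F U : ℝ) : ℂ)) (Complex.measurable_ofReal.comp hF)
    ⟨C, fun U => by simpa [Complex.norm_real, Real.norm_eq_abs] using hC U⟩
    (fun U V hUV => by simp only [hFpos U V hUV])
  have hre : (wilsonExpectation ρ β fun U : GaugeConfig d L G =>
      (starRingEnd ℂ) ((F U.timeReflect : ℝ) : ℂ) * ((F U : ℝ) : ℂ)) =
      ((∫ U, F (GaugeConfig.timeReflect U) * F U
          ∂(wilsonMeasure (d := d) (L := L) ρ β) : ℝ) : ℂ) := by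
    simp only [wilsonExpectation, Complex.conj_ofReal, ← Complex.ofReal_mul]
    exact integral_ofReal
  rw [hre] at h
  exact Complex.zero_le_real.1 h

/-- Real reading of the tree's site reflection positivity (`θ' t = −t`, `L` even, any `β`):
`0 ≤ ∫ F(Θ'U) F(U) dμ_β` for bounded measurable real `F` depending only on the closed positive
half `sitePosEdges ∪ sharedEdges`. [folklore] -/
theorem integral_negReflect_mul_nonneg [NeZero d] [NeZero L] (hL : Even L) (hρ : Continuous ρ)
    (β : ℝ) (F : GaugeConfig d L G → ℝ) (hF : Measurable F) (hFb : ∃ C : ℝ, ∀ U, |F U| ≤ C)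
    (hFdep : DependsOn F ((WilsonSiteRP.sitePosEdges ∪ WilsonSiteRP.sharedEdges :
        Finset (Edge d L)) : Set (Edge d L))) :
    0 ≤ ∫ U, F (GaugeConfig.negReflect U) * F U ∂(wilsonMeasure (d := d) (L := L) ρ β) := by
  obtain ⟨C, hC⟩ := hFb
  have h := wilsonExpectation_siteReflectionPositive (d := d) (L := L) ρ hL hρ β
    (fun U => ((F U : ℝ) : ℂ)) (Complex.measurable_ofReal.comp hF)
    ⟨C, fun U => by simpa [Complex.norm_real, Real.norm_eq_abs] using hC U⟩
    (fun U V hUV => by simp only [hFdep hUV])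
  have hre : (wilsonExpectation ρ β fun U : GaugeConfig d L G =>
      (starRingEnd ℂ) ((F U.negReflect : ℝ) : ℂ) * ((F U : ℝ) : ℂ)) =
      ((∫ U, F (GaugeConfig.negReflect U) * F U
          ∂(wilsonMeasure (d := d) (L := L) ρ β) : ℝ) : ℂ) := by
    simp only [wilsonExpectation, Complex.conj_ofReal, ← Complex.ofReal_mul]
    exact integral_ofReal
  rw [hre] at h
  exact Complex.zero_le_real.1 h

/-- Real reading of the tree's odd-torus reflection positivity (`θ t = 1 − t`, `L` odd, `L ≥ 3`,
`β ≥ 0`): `0 ≤ ∫ F(Θ₀U) F(U) dμ_β` for bounded measurable real `F` depending only on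
`oPosEdges ∪ oSharedEdges`. [folklore] -/
theorem integral_timeReflect_mul_nonneg_odd [NeZero d] [NeZero L] (hL : Odd L) (hL3 : 3 ≤ L)
    (hρ : Continuous ρ) {β : ℝ} (hβ : 0 ≤ β) (F : GaugeConfig d L G → ℝ) (hF : Measurable F)
    (hFb : ∃ C : ℝ, ∀ U, |F U| ≤ C)
    (hFdep : DependsOn F ((WilsonOddRP.oPosEdges ∪ WilsonOddRP.oSharedEdges :
        Finset (Edge d L)) : Set (Edge d L))) :
    0 ≤ ∫ U, F (GaugeConfig.timeReflect U) * F U ∂(wilsonMeasure (d := d) (L := L) ρ β) := by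
  obtain ⟨C, hC⟩ := hFb
  have h := wilsonExpectation_oddReflectionPositive (d := d) (L := L) ρ hL hL3 hρ hβ
    (fun U => ((F U : ℝ) : ℂ)) (Complex.measurable_ofReal.comp hF)
    ⟨C, fun U => by simpa [Complex.norm_real, Real.norm_eq_abs] using hC U⟩
    (fun U V hUV => by simp only [hFdep hUV])
  have hre : (wilsonExpectation ρ β fun U : GaugeConfig d L G =>
      (starRingEnd ℂ) ((F U.timeReflect : ℝ) : ℂ) * ((F U : ℝ) : ℂ)) =
      ((∫ U, F (GaugeConfig.timeReflect U) * F U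
          ∂(wilsonMeasure (d := d) (L := L) ρ β) : ℝ) : ℂ) := by
    simp only [wilsonExpectation, Complex.conj_ofReal, ← Complex.ofReal_mul]
    exact integral_ofReal
  rw [hre] at h
  exact Complex.zero_le_real.1 h

end RealRP

/-! ## Spatial plaquettes on the time axis: dependence, time coordinates, reflections -/

section Plaquettes

variable {d L N : ℕ} {G : Type*} [Group G] (ρ : G →* Matrix (Fin N) (Fin N) ℂ)

/-- `Re tr ρ(U_p)` depends only on the four links of `p`. [folklore] -/
theorem dependsOn_plaqRe (p : Plaquette d L) :
    DependsOn (fun U : GaugeConfig d L G => WilsonRP.plaqRe ρ U p)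
      ({(p.1, p.2.1.1), (p.1.shift p.2.1.1, p.2.1.2), (p.1.shift p.2.1.2, p.2.1.1), (p.1, p.2.1.2)} :
        Set (Edge d L)) := by
  intro U V hUV
  simp only [WilsonRP.plaqRe, plaquetteHolonomy]
  rw [hUV _ (by simp), hUV (p.1.shift p.2.1.1, p.2.1.2) (by simp),
    hUV (p.1.shift p.2.1.2, p.2.1.1) (by simp), hUV (p.1, p.2.1.2) (by simp)]

/-- Shifted by a constant, still depending on the same links. [folklore] -/
theorem dependsOn_plaqRe_sub_const (p : Plaquette d L) (c : ℝ) :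
    DependsOn (fun U : GaugeConfig d L G => WilsonRP.plaqRe ρ U p - c)
      ({(p.1, p.2.1.1), (p.1.shift p.2.1.1, p.2.1.2), (p.1.shift p.2.1.2, p.2.1.1), (p.1, p.2.1.2)} :
        Set (Edge d L)) := fun U V hUV => by
  have h := dependsOn_plaqRe ρ p hUV
  simp only at h
  show WilsonRP.plaqRe ρ U p - c = WilsonRP.plaqRe ρ V p - c
  rw [h]

variable [NeZero d]

/-- The four links of a SPATIAL plaquette all sit at the time of its base point. [folklore] -/
theorem time_of_mem_edges {p : Plaquette d L} (hp : p.2.1.1 ≠ 0) {e : Edge d L}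
    (he : e ∈ ({(p.1, p.2.1.1), (p.1.shift p.2.1.1, p.2.1.2), (p.1.shift p.2.1.2, p.2.1.1),
      (p.1, p.2.1.2)} : Set (Edge d L))) :
    e.2 ≠ 0 ∧ (e.1 0).val = (p.1 0).val ∧ ((e.1.shift e.2) 0).val = (p.1 0).val := by
  have hj : p.2.1.2 ≠ 0 := WilsonRP.plaq_snd_ne_zero p
  simp only [Set.mem_insert_iff, Set.mem_singleton_iff] at he
  rcases he with rfl | rfl | rfl | rfl
  · exact ⟨hp, rfl, by simp only [WilsonRP.shift_apply_of_ne _ hp.symm]⟩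
  · exact ⟨hj, by simp only [WilsonRP.shift_apply_of_ne _ hp.symm],
      by simp only [WilsonRP.shift_apply_of_ne _ hj.symm, WilsonRP.shift_apply_of_ne _ hp.symm]⟩
  · exact ⟨hp, by simp only [WilsonRP.shift_apply_of_ne _ hj.symm],
      by simp only [WilsonRP.shift_apply_of_ne _ hp.symm, WilsonRP.shift_apply_of_ne _ hj.symm]⟩
  · exact ⟨hj, rfl, by simp only [WilsonRP.shift_apply_of_ne _ hj.symm]⟩

/-- A spatial plaquette in the slab `1 ≤ t ≤ L/2` (shifted by a constant) is a positive-time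
observable for the link reflection. [folklore] -/
theorem isPositiveTimeObservable_plaqRe_sub {p : Plaquette d L} (hp : p.2.1.1 ≠ 0)
    (h1 : 1 ≤ (p.1 0).val) (h2 : (p.1 0).val ≤ L / 2) (c : ℝ) :
    IsPositiveTimeObservable (fun U : GaugeConfig d L G => WilsonRP.plaqRe ρ U p - c) := by
  intro U V hUV
  refine dependsOn_plaqRe_sub_const ρ p c fun e he => ?_
  obtain ⟨-, h0, hs⟩ := time_of_mem_edges hp he
  exact hUV e (h0 ▸ h1) (h0 ▸ h2) (hs ▸ h1) (hs ▸ h2)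

/-- A spatial plaquette in the open slab `1 ≤ t < L/2` depends only on site-positive links.
[folklore] -/
theorem dependsOn_plaqRe_sub_sitePos [NeZero L] {p : Plaquette d L} (hp : p.2.1.1 ≠ 0)
    (h1 : 1 ≤ (p.1 0).val) (h2 : (p.1 0).val < L / 2) (c : ℝ) :
    DependsOn (fun U : GaugeConfig d L G => WilsonRP.plaqRe ρ U p - c)
      ((WilsonSiteRP.sitePosEdges ∪ WilsonSiteRP.sharedEdges : Finset (Edge d L)) :
        Set (Edge d L)) := by
  intro U V hUV
  refine dependsOn_plaqRe_sub_const ρ p c fun e he => hUV e ?_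
  obtain ⟨he2, h0, -⟩ := time_of_mem_edges hp he
  rw [Finset.coe_union, Set.mem_union, Finset.mem_coe, Finset.mem_coe, WilsonSiteRP.mem_sitePosEdges]
  left
  simp only [WilsonSiteRP.IsSitePosEdge, he2, ↓reduceIte, h0]
  exact ⟨h1, h2⟩

/-- A spatial plaquette in the slab `1 ≤ t ≤ L/2` depends only on odd-positive links. [folklore] -/
theorem dependsOn_plaqRe_sub_oddPos [NeZero L] {p : Plaquette d L} (hp : p.2.1.1 ≠ 0)
    (h1 : 1 ≤ (p.1 0).val) (h2 : (p.1 0).val ≤ L / 2) (c : ℝ) :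
    DependsOn (fun U : GaugeConfig d L G => WilsonRP.plaqRe ρ U p - c)
      ((WilsonOddRP.oPosEdges ∪ WilsonOddRP.oSharedEdges : Finset (Edge d L)) :
        Set (Edge d L)) := by
  intro U V hUV
  refine dependsOn_plaqRe_sub_const ρ p c fun e he => hUV e ?_
  obtain ⟨-, h0, -⟩ := time_of_mem_edges hp he
  rw [Finset.coe_union, Set.mem_union, Finset.mem_coe, Finset.mem_coe, WilsonOddRP.mem_oPosEdges]
  left
  exact ⟨h0 ▸ h1, h0 ▸ h2⟩

/-- The link reflection maps a spatial plaquette to the spatial plaquette at the mirror time.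
[folklore] -/
theorem plaqReflect_of_ne {p : Plaquette d L} (hp : p.2.1.1 ≠ 0) :
    WilsonRP.plaqReflect p = (p.1.timeReflect, p.2) := by
  simp [WilsonRP.plaqReflect, hp]

/-- The site reflection maps a spatial plaquette to the spatial plaquette at the mirror time.
[folklore] -/
theorem sitePlaqReflect_of_ne {p : Plaquette d L} (hp : p.2.1.1 ≠ 0) :
    WilsonSiteRP.sitePlaqReflect p = (p.1.negReflect, p.2) := by
  simp [WilsonSiteRP.sitePlaqReflect, hp]

/-- Time axis sites: `θ(c e₀) = (1 − c) e₀`. [folklore] -/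
theorem timeReflect_single (c : ZMod L) :
    Site.timeReflect (Pi.single (0 : Fin d) c : Site d L) = (Pi.single (0 : Fin d) (1 - c) : Site d L) := by
  funext k
  by_cases hk : k = 0
  · subst hk; simp [Site.timeReflect]
  · simp [Site.timeReflect, hk]

/-- Time axis sites: `θ'(c e₀) = (−c) e₀`. [folklore] -/
theorem negReflect_single (c : ZMod L) :
    Site.negReflect (Pi.single (0 : Fin d) c : Site d L) = (Pi.single (0 : Fin d) (-c) : Site d L) := by
  funext k
  by_cases hk : k = 0
  · subst hk; simp [Site.negReflect]
  · simp [Site.negReflect, hk]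

end Plaquettes

/-! ## Mirror pairs have non-negative covariance -/

section Mirror

variable {d L N : ℕ} [NeZero d] [NeZero L] {G : Type*} [Group G] [TopologicalSpace G]
  [IsTopologicalGroup G] [CompactSpace G] [MeasurableSpace G] [BorelSpace G]
  (ρ : G →* Matrix (Fin N) (Fin N) ℂ)

/-- **Link-mirror pairs.** `L` even, `β ≥ 0`, `p` a spatial plaquette with `1 ≤ t ≤ L/2`:
`Cov(P_{θp}, P_p) ≥ 0` for the plaquette `θp` at the mirror time `1 − t`. [folklore] -/
theorem cov_timeReflect_pair_nonneg_even (hL : Even L) (hρ : Continuous ρ) {β : ℝ} (hβ : 0 ≤ β)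
    {p : Plaquette d L} (hp : p.2.1.1 ≠ 0) (h1 : 1 ≤ (p.1 0).val) (h2 : (p.1 0).val ≤ L / 2) :
    0 ≤ wilsonExpectation ρ β (fun U : GaugeConfig d L G =>
          WilsonRP.plaqRe ρ U (p.1.timeReflect, p.2) * WilsonRP.plaqRe ρ U p)
        - wilsonExpectation ρ β (fun U : GaugeConfig d L G =>
            WilsonRP.plaqRe ρ U (p.1.timeReflect, p.2))
          * wilsonExpectation ρ β (fun U : GaugeConfig d L G => WilsonRP.plaqRe ρ U p) := by
  haveI := isProbabilityMeasure_wilsonMeasure (d := d) (L := L) ρ hρ β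
  have hrefl : ∀ U : GaugeConfig d L G, WilsonRP.plaqRe ρ U.timeReflect p =
      WilsonRP.plaqRe ρ U (p.1.timeReflect, p.2) := fun U => by
    rw [WilsonRP.plaqRe_timeReflect ρ hρ U p, plaqReflect_of_ne hp]
  have hFb : ∃ C : ℝ, ∀ U : GaugeConfig d L G, |WilsonRP.plaqRe ρ U p| ≤ C :=
    ⟨N, fun U => WilsonRP.abs_plaqRe_le ρ hρ U p⟩
  set m : ℝ := ∫ U, WilsonRP.plaqRe ρ U p ∂(wilsonMeasure (d := d) (L := L) ρ β) with hm
  have hc : 0 ≤ ∫ U, (WilsonRP.plaqRe ρ U.timeReflect p - m) * (WilsonRP.plaqRe ρ U p - m)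
      ∂(wilsonMeasure (d := d) (L := L) ρ β) :=
    integral_timeReflect_mul_nonneg_even ρ hL hρ hβ (fun U => WilsonRP.plaqRe ρ U p - m)
      ((WilsonRP.measurable_plaqRe ρ hρ p).sub_const m)
      ⟨N + |m|, fun U => (abs_sub _ _).trans (add_le_add (WilsonRP.abs_plaqRe_le ρ hρ U p) le_rfl)⟩
      (isPositiveTimeObservable_plaqRe_sub ρ hp h1 h2 m)
  have key := cov_comp_nonneg_of_centred (μ := wilsonMeasure (d := d) (L := L) ρ β)
    WilsonRP.measurable_timeReflect
    (FiniteSusceptibilityWeakCoupling.RPCauchySchwarz.wilsonMeasure_map_timeReflect ρ hρ β)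
    (WilsonRP.measurable_plaqRe ρ hρ p) hFb hc
  simpa only [hrefl, wilsonExpectation] using key

/-- **Site-mirror pairs.** `L` even, any `β`, `p` a spatial plaquette with `1 ≤ t < L/2`:
`Cov(P_{θ'p}, P_p) ≥ 0` for the plaquette `θ'p` at the mirror time `−t`. [folklore] -/
theorem cov_negReflect_pair_nonneg (hL : Even L) (hρ : Continuous ρ) (β : ℝ)
    {p : Plaquette d L} (hp : p.2.1.1 ≠ 0) (h1 : 1 ≤ (p.1 0).val) (h2 : (p.1 0).val < L / 2) :
    0 ≤ wilsonExpectation ρ β (fun U : GaugeConfig d L G =>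
          WilsonRP.plaqRe ρ U (p.1.negReflect, p.2) * WilsonRP.plaqRe ρ U p)
        - wilsonExpectation ρ β (fun U : GaugeConfig d L G =>
            WilsonRP.plaqRe ρ U (p.1.negReflect, p.2))
          * wilsonExpectation ρ β (fun U : GaugeConfig d L G => WilsonRP.plaqRe ρ U p) := by
  haveI := isProbabilityMeasure_wilsonMeasure (d := d) (L := L) ρ hρ β
  haveI : Fact (1 < L) := ⟨by obtain ⟨r, hr⟩ := hL; have := NeZero.ne L; omega⟩
  have hrefl : ∀ U : GaugeConfig d L G, WilsonRP.plaqRe ρ U.negReflect p =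
      WilsonRP.plaqRe ρ U (p.1.negReflect, p.2) := fun U => by
    rw [WilsonSiteRP.plaqRe_negReflect ρ hρ U p, sitePlaqReflect_of_ne hp]
  have hFb : ∃ C : ℝ, ∀ U : GaugeConfig d L G, |WilsonRP.plaqRe ρ U p| ≤ C :=
    ⟨N, fun U => WilsonRP.abs_plaqRe_le ρ hρ U p⟩
  set m : ℝ := ∫ U, WilsonRP.plaqRe ρ U p ∂(wilsonMeasure (d := d) (L := L) ρ β) with hm
  have hc : 0 ≤ ∫ U, (WilsonRP.plaqRe ρ U.negReflect p - m) * (WilsonRP.plaqRe ρ U p - m)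
      ∂(wilsonMeasure (d := d) (L := L) ρ β) :=
    integral_negReflect_mul_nonneg ρ hL hρ β (fun U => WilsonRP.plaqRe ρ U p - m)
      ((WilsonRP.measurable_plaqRe ρ hρ p).sub_const m)
      ⟨N + |m|, fun U => (abs_sub _ _).trans (add_le_add (WilsonRP.abs_plaqRe_le ρ hρ U p) le_rfl)⟩
      (dependsOn_plaqRe_sub_sitePos ρ hp h1 h2 m)
  have key := cov_comp_nonneg_of_centred (μ := wilsonMeasure (d := d) (L := L) ρ β)
    WilsonSiteRP.measurable_negReflect
    (WilsonSiteRP.wilsonMeasure_map_negReflect ρ hL hρ β)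
    (WilsonRP.measurable_plaqRe ρ hρ p) hFb hc
  simpa only [hrefl, wilsonExpectation] using key

/-- **Odd-torus mirror pairs.** `L` odd, `L ≥ 3`, `β ≥ 0`, `p` a spatial plaquette with
`1 ≤ t ≤ L/2`: `Cov(P_{θp}, P_p) ≥ 0` for the plaquette `θp` at the mirror time `1 − t`. [folklore] -/
theorem cov_timeReflect_pair_nonneg_odd (hL : Odd L) (hL3 : 3 ≤ L) (hρ : Continuous ρ) {β : ℝ}
    (hβ : 0 ≤ β) {p : Plaquette d L} (hp : p.2.1.1 ≠ 0) (h1 : 1 ≤ (p.1 0).val)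
    (h2 : (p.1 0).val ≤ L / 2) :
    0 ≤ wilsonExpectation ρ β (fun U : GaugeConfig d L G =>
          WilsonRP.plaqRe ρ U (p.1.timeReflect, p.2) * WilsonRP.plaqRe ρ U p)
        - wilsonExpectation ρ β (fun U : GaugeConfig d L G =>
            WilsonRP.plaqRe ρ U (p.1.timeReflect, p.2))
          * wilsonExpectation ρ β (fun U : GaugeConfig d L G => WilsonRP.plaqRe ρ U p) := by
  haveI := isProbabilityMeasure_wilsonMeasure (d := d) (L := L) ρ hρ β
  have hrefl : ∀ U : GaugeConfig d L G, WilsonRP.plaqRe ρ U.timeReflect p =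
      WilsonRP.plaqRe ρ U (p.1.timeReflect, p.2) := fun U => by
    rw [WilsonRP.plaqRe_timeReflect ρ hρ U p, plaqReflect_of_ne hp]
  have hFb : ∃ C : ℝ, ∀ U : GaugeConfig d L G, |WilsonRP.plaqRe ρ U p| ≤ C :=
    ⟨N, fun U => WilsonRP.abs_plaqRe_le ρ hρ U p⟩
  set m : ℝ := ∫ U, WilsonRP.plaqRe ρ U p ∂(wilsonMeasure (d := d) (L := L) ρ β) with hm
  have hc : 0 ≤ ∫ U, (WilsonRP.plaqRe ρ U.timeReflect p - m) * (WilsonRP.plaqRe ρ U p - m)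
      ∂(wilsonMeasure (d := d) (L := L) ρ β) :=
    integral_timeReflect_mul_nonneg_odd ρ hL hL3 hρ hβ (fun U => WilsonRP.plaqRe ρ U p - m)
      ((WilsonRP.measurable_plaqRe ρ hρ p).sub_const m)
      ⟨N + |m|, fun U => (abs_sub _ _).trans (add_le_add (WilsonRP.abs_plaqRe_le ρ hρ U p) le_rfl)⟩
      (dependsOn_plaqRe_sub_oddPos ρ hp h1 h2 m)
  have key := cov_comp_nonneg_of_centred (μ := wilsonMeasure (d := d) (L := L) ρ β)
    WilsonRP.measurable_timeReflect
    (FiniteSusceptibilityWeakCoupling.RPCauchySchwarz.wilsonMeasure_map_timeReflect ρ hρ β)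
    (WilsonRP.measurable_plaqRe ρ hρ p) hFb hc
  simpa only [hrefl, wilsonExpectation] using key

end Mirror

end Summit.QuantumFields.YangMills.Theorems.FemtoCurvatureTwoPoint.AxisCovNonneg

namespace Summit.QuantumFields.YangMills.Theorems.FemtoCurvatureTwoPoint

/-- **Registered sub-goal `stub_mirrorPairCovNonneg`** (`--supports stmt-QuantumFields-9363`): link-mirror
plaquette pairs have non-negative covariance on even tori at `β ≥ 0` (closed form of
`AxisCovNonneg.cov_timeReflect_pair_nonneg_even`, fully qualified). [folklore] -/
theorem stub_mirrorPairCovNonneg : ∀ (d L N : ℕ) [NeZero d] [NeZero L] (G : Type) [Group G] [TopologicalSpace G] [IsTopologicalGroup G] [CompactSpace G] [MeasurableSpace G] [BorelSpace G] (ρ : G →* Matrix (Fin N) (Fin N) ℂ), Continuous ρ → Even L → ∀ (β : ℝ), 0 ≤ β → ∀ (p : Literature.MathematicalPhysics.QuantumFieldTheory.Plaquette d L), p.2.1.1 ≠ 0 → 1 ≤ (p.1 0).val → (p.1 0).val ≤ L / 2 → 0 ≤ Literature.MathematicalPhysics.QuantumFieldTheory.wilsonExpectation ρ β (fun U : Literature.MathematicalPhysics.QuantumFieldTheory.GaugeConfig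 d L G => Literature.MathematicalPhysics.QuantumFieldTheory.WilsonRP.plaqRe ρ U (Literature.MathematicalPhysics.QuantumFieldTheory.Site.timeReflect p.1, p.2) * Literature.MathematicalPhysics.QuantumFieldTheory.WilsonRP.plaqRe ρ U p) - Literature.MathematicalPhysics.QuantumFieldTheory.wilsonExpectation ρ β (fun U : Literature.MathematicalPhysics.QuantumFieldTheory.GaugeConfig d L G => Literature.MathematicalPhysics.QuantumFieldTheory.WilsonRP.plaqRe ρ U (Literature.MathematicalPhysics.QuantumFieldTheory.Site.timeReflect p.1, p.2)) * Literature.MathematicalPhysics.QuantumFieldTheory.wilsonExpectation ρ β (fun U : Literature.MathematicalPhysics.QuantumFieldTheory.GaugeConfig d L G => Literature.MathematicalPhysics.QuantumFieldTheory.WilsonRP.plaqRe ρ U p) := by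
  intro d L N _ _ G _ _ _ _ _ _ ρ hρ hL β hβ p hp h1 h2
  exact AxisCovNonneg.cov_timeReflect_pair_nonneg_even ρ hL hρ hβ hp h1 h2

end Summit.QuantumFields.YangMills.Theorems.FemtoCurvatureTwoPoint

end
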